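import Summits.ValiantsHypothesis.ValiantsHypothesis.Theorems.LacunarySymmetroidMatrixDescartesDoorA26WallBubblingMixThreeCases
import Summits.ValiantsHypothesis.ValiantsHypothesis.Theorems.LacunarySymmetroidMatrixDescartesDoorA26WallBubblingTwoPairTripleTop
import Summits.ValiantsHypothesis.ValiantsHypothesis.Theorems.LacunarySymmetroidMatrixDescartesDoorA26WallBubblingThreeScaleTriple

/-!
# Wall bubbling for `DoorA26` — TWO WEYL PAIRS: THE REPAIRED THREE-SCALE RULE `MixThree26'` AT ONE STAGE (symmetric letters)

HONEST FRAMING.  Obligation (W) `stub_weylFaces` of `Cruxes/DoorA26/Lines/wall_bubbling.lean` (crux `DoorA26`, stmt-ValiantsHypothesis-19979; OPEN,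
typed, never asserted); W1 seat val-sym-door-p2 g14; fifth file towards `MixThree26'` (rev 9 of `Lines/wall_bubbling_ConfluentDoor.lean`).
The matrix-level ONE-STAGE form of the repaired rule: SYMMETRIC letters `U`, exponents `δ` with `δ 0 ≠ δ 1`, the two-dslope frames at the scales
`0`, `L₁`, `L₁ + L₂` (explicit), the scale-0 bounds, the dominations of the mixed and pure entries at the two later scales, a mixed degree-1
member alive at each scale, the growth facts of the transvection coefficients and the kill inequality
`122880·Φ¹⁸·e^{−|δ₀−δ₁|(L₁+L₂)} < κ₁⁴κ₂²κ₃³` are contradictory (`mixThree_stage`).  Mechanism: W1 #46 `frame_shift₂` identities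
(`mixed_frameShift`, W2 `triple_frameShift`, W1 `triple_frameShift₁₄`), the Lorentz–Gram `D`-bound of the dominant pure class
(`mixThree_Dsq_le₀/₁` — the ONLY use of symmetry), and the scalar case analysis `mixThree_scalar`.  Also the size lemma `frameSize_le` and the
asymptotic kill `eventually_kill` used by the `∀ᶠ` assembly (next file).

Registers unchanged; (W), `MixThree26'`, `DoorA26` 19979, 18050 OPEN; nothing on VP ≠ VNP.  Def-free.  `--supports stmt-ValiantsHypothesis-19979 --as helper`.
-/

-- `Summit.ValiantsHypothesis.ValiantsHypothesis.…` repeats a component by the D-0017 layout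
-- (single-conjunct summit), which the `dupNamespace` linter flags; the name is mandated.
set_option linter.dupNamespace false

namespace Summit.ValiantsHypothesis.ValiantsHypothesis.Theorems.LacunarySymmetroidMatrixDescartes.WallBubbling

open Finset Filter Topology
open Bubbling (polar polar_apply polar_comm polar_smul_left_right)
open scoped BigOperators

/-! ## 1. Size of the frame data and the asymptotic kill -/

/-- **SIZE OF THE TRANSVECTION DATA AT A SCALE `S ≤ T`.**  `1 + |Λ| + |Λ'| + e + e' + e⁻¹ + e'⁻¹ ≤ 7·T·e^{(|w|+|w'|)T}` for `0 ≤ S ≤ T`, `1 ≤ T`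
(W2 `abs_dslope_exp_le`). [this work] -/
theorem frameSize_le (w w' S T : ℝ) (hS : 0 ≤ S) (hST : S ≤ T) (hT : 1 ≤ T) :
    1 + |dslope (fun y : ℝ => Real.exp (y * S)) 0 w| + |dslope (fun y : ℝ => Real.exp (y * S)) 0 w'|
      + Real.exp (w * S) + Real.exp (w' * S) + (Real.exp (w * S))⁻¹ + (Real.exp (w' * S))⁻¹
      ≤ 7 * T * Real.exp ((|w| + |w'|) * T) := by
  set X := Real.exp ((|w| + |w'|) * T) with hX
  have hT0 : 0 ≤ T := le_trans zero_le_one hT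
  have hX1 : 1 ≤ X := Real.one_le_exp (by positivity)
  have habsS : |S| = S := abs_of_nonneg hS
  have hw0 : 0 ≤ |w| := abs_nonneg _
  have hw'0 : 0 ≤ |w'| := abs_nonneg _
  have expo : ∀ {v : ℝ}, |v| ≤ |w| + |w'| → ∀ (s : ℝ), s = v * S ∨ s = -(v * S) → Real.exp s ≤ X := by
    intro v hv s hs
    rw [hX]
    apply Real.exp_le_exp.mpr
    have h1 : v * S ≤ |v| * S := mul_le_mul_of_nonneg_right (le_abs_self v) hS
    have h2 : -(v * S) ≤ |v| * S := by have := neg_abs_le v; nlinarith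
    have h3 : |v| * S ≤ (|w| + |w'|) * T := mul_le_mul hv hST hS (by positivity)
    rcases hs with rfl | rfl <;> linarith
  have hΛ : |dslope (fun y : ℝ => Real.exp (y * S)) 0 w| ≤ T * X := by
    have t := abs_dslope_exp_le S w
    rw [habsS] at t
    have t2 : Real.exp (|w| * S) ≤ X := expo (v := |w|) (by rw [abs_abs]; linarith) _ (Or.inl rfl)
    calc _ ≤ S * Real.exp (|w| * S) := t
      _ ≤ T * X := mul_le_mul hST t2 (Real.exp_pos _).le hT0
  have hΛ' : |dslope (fun y : ℝ => Real.exp (y * S)) 0 w'| ≤ T * X := by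
    have t := abs_dslope_exp_le S w'
    rw [habsS] at t
    have t2 : Real.exp (|w'| * S) ≤ X := expo (v := |w'|) (by rw [abs_abs]; linarith) _ (Or.inl rfl)
    calc _ ≤ S * Real.exp (|w'| * S) := t
      _ ≤ T * X := mul_le_mul hST t2 (Real.exp_pos _).le hT0
  have he : Real.exp (w * S) ≤ X := expo (le_add_of_nonneg_right hw'0) _ (Or.inl rfl)
  have he' : Real.exp (w' * S) ≤ X := expo (le_add_of_nonneg_left hw0) _ (Or.inl rfl)
  have hi : (Real.exp (w * S))⁻¹ ≤ X := by rw [← Real.exp_neg]; exact expo (le_add_of_nonneg_right hw'0) _ (Or.inr rfl)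
  have hi' : (Real.exp (w' * S))⁻¹ ≤ X := by rw [← Real.exp_neg]; exact expo (le_add_of_nonneg_left hw0) _ (Or.inr rfl)
  have hTX : X ≤ T * X := by nlinarith
  have h1X : 1 ≤ T * X := le_trans hX1 hTX
  linarith

/-- **THE ASYMPTOTIC KILL.**  `T → +∞`, eventually `a ≤ −c` and `b ≤ c/36` (`c > 0`) ⇒ eventually `122880·(7T e^{bT})¹⁸·e^{aT} < K`. [this work] -/
theorem eventually_kill (T a b : ℕ → ℝ) (hT : Tendsto T atTop atTop) (c : ℝ) (hc : 0 < c)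
    (ha : ∀ᶠ ν in atTop, a ν ≤ -c) (hb : ∀ᶠ ν in atTop, b ν ≤ c / 36) (K : ℝ) (hK : 0 < K) :
    ∀ᶠ ν in atTop, 122880 * (7 * T ν * Real.exp (b ν * T ν)) ^ 18 * Real.exp (a ν * T ν) < K := by
  -- `u = (c/2)·T → ∞` and `u¹⁸ e^{−u} → 0`
  have hu : Tendsto (fun ν => c / 2 * T ν) atTop atTop := hT.const_mul_atTop (by positivity)
  have hlim : Tendsto (fun ν => (c / 2 * T ν) ^ 18 * Real.exp (-(c / 2 * T ν))) atTop (𝓝 0) :=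
    (Real.tendsto_pow_mul_exp_neg_atTop_nhds_zero 18).comp hu
  set C : ℝ := 122880 * 7 ^ 18 * (2 / c) ^ 18 with hC
  have hCpos : 0 < C := by rw [hC]; positivity
  have hsmall : ∀ᶠ ν in atTop, (c / 2 * T ν) ^ 18 * Real.exp (-(c / 2 * T ν)) < K / C :=
    (tendsto_order.1 hlim).2 _ (by positivity)
  have hT0 : ∀ᶠ ν in atTop, 0 ≤ T ν := hT.eventually_ge_atTop 0
  filter_upwards [ha, hb, hsmall, hT0] with ν haν hbν hsν hTν
  -- exponent bound: `18 b T + a T ≤ −(c/2) T`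
  have hexp : Real.exp (b ν * T ν) ^ 18 * Real.exp (a ν * T ν) ≤ Real.exp (-(c / 2 * T ν)) := by
    rw [← Real.exp_nat_mul, ← Real.exp_add]
    apply Real.exp_le_exp.mpr
    have : (18 : ℝ) * b ν + a ν ≤ -(c / 2) := by linarith
    nlinarith
  have hmain : 122880 * (7 * T ν * Real.exp (b ν * T ν)) ^ 18 * Real.exp (a ν * T ν)
      ≤ C * ((c / 2 * T ν) ^ 18 * Real.exp (-(c / 2 * T ν))) := by
    have e1 : 122880 * (7 * T ν * Real.exp (b ν * T ν)) ^ 18 * Real.exp (a ν * T ν)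
        = (122880 * 7 ^ 18 * T ν ^ 18) * (Real.exp (b ν * T ν) ^ 18 * Real.exp (a ν * T ν)) := by ring
    have e2 : C * ((c / 2 * T ν) ^ 18 * Real.exp (-(c / 2 * T ν)))
        = (122880 * 7 ^ 18 * T ν ^ 18) * ((2 / c) ^ 18 * (c / 2) ^ 18) * Real.exp (-(c / 2 * T ν)) := by rw [hC]; ring
    have e3 : (2 / c) ^ 18 * (c / 2) ^ 18 = 1 := by
      rw [← mul_pow]; rw [show (2 : ℝ) / c * (c / 2) = 1 by field_simp]; simp
    rw [e1, e2, e3, mul_one]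
    exact mul_le_mul_of_nonneg_left hexp (by positivity)
  have : C * ((c / 2 * T ν) ^ 18 * Real.exp (-(c / 2 * T ν))) < C * (K / C) := mul_lt_mul_of_pos_left hsν hCpos
  rw [mul_div_cancel₀ K hCpos.ne'] at this
  linarith
/-- `12Φ⁶ε ≤ κ₃` from the kill inequality (all `κ ≤ 1`, `Φ ≥ 1`). [this work] -/
theorem kill_small {κ₁ κ₂ κ₃ Φ ε : ℝ} (hκ₁ : 0 < κ₁) (hκ₂ : 0 < κ₂) (hκ₃ : 0 < κ₃) (hκ₁1 : κ₁ ≤ 1) (hκ₂1 : κ₂ ≤ 1) (hκ₃1 : κ₃ ≤ 1)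
    (hΦ1 : 1 ≤ Φ) (hε : 0 < ε) (hkill : 122880 * Φ ^ 18 * ε < κ₁ ^ 4 * κ₂ ^ 2 * κ₃ ^ 3) : 12 * Φ ^ 6 * ε ≤ κ₃ := by
  have hΦ618 : Φ ^ 6 ≤ Φ ^ 18 := pow_le_pow_right₀ hΦ1 (by norm_num)
  have t1 : Φ ^ 6 * ε ≤ Φ ^ 18 * ε := mul_le_mul_of_nonneg_right hΦ618 hε.le
  have a := pow_le_one₀ hκ₁.le hκ₁1 (n := 4)
  have b := pow_le_one₀ hκ₂.le hκ₂1 (n := 2)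
  have hk12 : κ₁ ^ 4 * κ₂ ^ 2 ≤ 1 := by
    have := mul_le_mul a b (pow_nonneg hκ₂.le 2) zero_le_one
    linarith
  have hk3 : κ₃ ^ 3 ≤ κ₃ := by
    have := mul_le_mul_of_nonneg_left (pow_le_one₀ hκ₃.le hκ₃1 (n := 2)) hκ₃.le
    calc κ₃ ^ 3 = κ₃ * κ₃ ^ 2 := by ring
      _ ≤ κ₃ * 1 := this
      _ = κ₃ := mul_one κ₃
  have t2 : κ₁ ^ 4 * κ₂ ^ 2 * κ₃ ^ 3 ≤ κ₃ := by
    have := mul_le_mul hk12 hk3 (pow_nonneg hκ₃.le 3) zero_le_one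
    linarith
  have t0 : 0 ≤ Φ ^ 6 * ε := by positivity
  linarith

/-- **THE REPAIRED THREE-SCALE RULE AT ONE STAGE** (symmetric letters, `δ 0 ≠ δ 1`; explicit two-dslope frames at the scales `0`, `L₁`,
`L₁ + L₂`); see the module docstring. [this work] -/
theorem mixThree_stage (δ : Fin 6 → ℝ) (U : Fin 6 → Matrix (Fin 2) (Fin 2) ℝ) (hU : ∀ l, (U l).IsSymm) (hne : δ 0 ≠ δ 1)
    (L₁ L₂ μ₁ μ₂ μ₃ κ₁ κ₂ κ₃ Φ : ℝ) (hμ₁ : 0 < μ₁) (hκ₁ : 0 < κ₁) (hκ₂ : 0 < κ₂) (hκ₃ : 0 < κ₃)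
    (hκ₁1 : κ₁ ≤ 1) (hκ₂1 : κ₂ ≤ 1) (hκ₃1 : κ₃ ≤ 1)
    (b00 : |polar (U 0 + U 5) (U 0 + U 5)| ≤ μ₁) (b05 : |polar (U 0 + U 5) ((δ 5 - δ 0) • U 5)| ≤ μ₁)
    (b55 : |polar ((δ 5 - δ 0) • U 5) ((δ 5 - δ 0) • U 5)| ≤ μ₁) (b11 : |polar (U 1 + U 4) (U 1 + U 4)| ≤ μ₁)
    (b14 : |polar (U 1 + U 4) ((δ 4 - δ 1) • U 4)| ≤ μ₁) (b44 : |polar ((δ 4 - δ 1) • U 4) ((δ 4 - δ 1) • U 4)| ≤ μ₁)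
    (b01 : |polar (U 0 + U 5) (U 1 + U 4)| ≤ μ₁) (b04 : |polar (U 0 + U 5) ((δ 4 - δ 1) • U 4)| ≤ μ₁)
    (b51 : |polar ((δ 5 - δ 0) • U 5) (U 1 + U 4)| ≤ μ₁) (b54 : |polar ((δ 5 - δ 0) • U 5) ((δ 4 - δ 1) • U 4)| ≤ μ₁)
    (hal₁ : κ₁ * μ₁ ≤ |polar (U 0 + U 5) ((δ 4 - δ 1) • U 4)| ∨ κ₁ * μ₁ ≤ |polar ((δ 5 - δ 0) • U 5) (U 1 + U 4)|)
    (d01₂ : |polar (Real.exp (δ 0 * L₁) • U 0 + Real.exp (δ 5 * L₁) • U 5)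
        (Real.exp (δ 1 * L₁) • U 1 + Real.exp (δ 4 * L₁) • U 4)| ≤ μ₂)
    (d04₂ : |polar (Real.exp (δ 0 * L₁) • U 0 + Real.exp (δ 5 * L₁) • U 5)
        ((δ 4 - δ 1) • (Real.exp (δ 4 * L₁) • U 4))| ≤ μ₂)
    (d51₂ : |polar ((δ 5 - δ 0) • (Real.exp (δ 5 * L₁) • U 5))
        (Real.exp (δ 1 * L₁) • U 1 + Real.exp (δ 4 * L₁) • U 4)| ≤ μ₂)
    (d54₂ : |polar ((δ 5 - δ 0) • (Real.exp (δ 5 * L₁) • U 5))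
        ((δ 4 - δ 1) • (Real.exp (δ 4 * L₁) • U 4))| ≤ μ₂)
    (al₂ : κ₂ * μ₂ ≤ |polar (Real.exp (δ 0 * L₁) • U 0 + Real.exp (δ 5 * L₁) • U 5)
        ((δ 4 - δ 1) • (Real.exp (δ 4 * L₁) • U 4))| ∨
      κ₂ * μ₂ ≤ |polar ((δ 5 - δ 0) • (Real.exp (δ 5 * L₁) • U 5))
        (Real.exp (δ 1 * L₁) • U 1 + Real.exp (δ 4 * L₁) • U 4)|)
    (d00₃ : |polar (Real.exp (δ 0 * (L₁ + L₂)) • U 0 + Real.exp (δ 5 * (L₁ + L₂)) • U 5)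
        (Real.exp (δ 0 * (L₁ + L₂)) • U 0 + Real.exp (δ 5 * (L₁ + L₂)) • U 5)| ≤ μ₃)
    (d05₃ : |polar (Real.exp (δ 0 * (L₁ + L₂)) • U 0 + Real.exp (δ 5 * (L₁ + L₂)) • U 5)
        ((δ 5 - δ 0) • (Real.exp (δ 5 * (L₁ + L₂)) • U 5))| ≤ μ₃)
    (d55₃ : |polar ((δ 5 - δ 0) • (Real.exp (δ 5 * (L₁ + L₂)) • U 5))
        ((δ 5 - δ 0) • (Real.exp (δ 5 * (L₁ + L₂)) • U 5))| ≤ μ₃)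
    (d11₃ : |polar (Real.exp (δ 1 * (L₁ + L₂)) • U 1 + Real.exp (δ 4 * (L₁ + L₂)) • U 4)
        (Real.exp (δ 1 * (L₁ + L₂)) • U 1 + Real.exp (δ 4 * (L₁ + L₂)) • U 4)| ≤ μ₃)
    (d14₃ : |polar (Real.exp (δ 1 * (L₁ + L₂)) • U 1 + Real.exp (δ 4 * (L₁ + L₂)) • U 4)
        ((δ 4 - δ 1) • (Real.exp (δ 4 * (L₁ + L₂)) • U 4))| ≤ μ₃)
    (d44₃ : |polar ((δ 4 - δ 1) • (Real.exp (δ 4 * (L₁ + L₂)) • U 4))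
        ((δ 4 - δ 1) • (Real.exp (δ 4 * (L₁ + L₂)) • U 4))| ≤ μ₃)
    (d01₃ : |polar (Real.exp (δ 0 * (L₁ + L₂)) • U 0 + Real.exp (δ 5 * (L₁ + L₂)) • U 5)
        (Real.exp (δ 1 * (L₁ + L₂)) • U 1 + Real.exp (δ 4 * (L₁ + L₂)) • U 4)| ≤ μ₃)
    (d04₃ : |polar (Real.exp (δ 0 * (L₁ + L₂)) • U 0 + Real.exp (δ 5 * (L₁ + L₂)) • U 5)
        ((δ 4 - δ 1) • (Real.exp (δ 4 * (L₁ + L₂)) • U 4))| ≤ μ₃)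
    (d51₃ : |polar ((δ 5 - δ 0) • (Real.exp (δ 5 * (L₁ + L₂)) • U 5))
        (Real.exp (δ 1 * (L₁ + L₂)) • U 1 + Real.exp (δ 4 * (L₁ + L₂)) • U 4)| ≤ μ₃)
    (d54₃ : |polar ((δ 5 - δ 0) • (Real.exp (δ 5 * (L₁ + L₂)) • U 5))
        ((δ 4 - δ 1) • (Real.exp (δ 4 * (L₁ + L₂)) • U 4))| ≤ μ₃)
    (al₃ : κ₃ * μ₃ ≤ |polar (Real.exp (δ 0 * (L₁ + L₂)) • U 0 + Real.exp (δ 5 * (L₁ + L₂)) • U 5)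
        ((δ 4 - δ 1) • (Real.exp (δ 4 * (L₁ + L₂)) • U 4))| ∨
      κ₃ * μ₃ ≤ |polar ((δ 5 - δ 0) • (Real.exp (δ 5 * (L₁ + L₂)) • U 5))
        (Real.exp (δ 1 * (L₁ + L₂)) • U 1 + Real.exp (δ 4 * (L₁ + L₂)) • U 4)|)
    (hΦ₂ : 1 + |dslope (fun y : ℝ => Real.exp (y * L₁)) 0 (δ 5 - δ 0)| + |dslope (fun y : ℝ => Real.exp (y * L₁)) 0 (δ 4 - δ 1)|
      + Real.exp ((δ 5 - δ 0) * L₁) + Real.exp ((δ 4 - δ 1) * L₁) + (Real.exp ((δ 5 - δ 0) * L₁))⁻¹ + (Real.exp ((δ 4 - δ 1) * L₁))⁻¹ ≤ Φ)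
    (hΦ₃ : 1 + |dslope (fun y : ℝ => Real.exp (y * (L₁ + L₂))) 0 (δ 5 - δ 0)| + |dslope (fun y : ℝ => Real.exp (y * (L₁ + L₂))) 0 (δ 4 - δ 1)|
      + Real.exp ((δ 5 - δ 0) * (L₁ + L₂)) + Real.exp ((δ 4 - δ 1) * (L₁ + L₂)) + (Real.exp ((δ 5 - δ 0) * (L₁ + L₂)))⁻¹ + (Real.exp ((δ 4 - δ 1) * (L₁ + L₂)))⁻¹ ≤ Φ)
    (gΛ₂ : 1 / κ₂ * Real.exp ((δ 5 - δ 0) * L₁) + (1 / κ₁ + 1) < |dslope (fun y : ℝ => Real.exp (y * L₁)) 0 (δ 5 - δ 0)|)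
    (gΛ₃ : 1 / κ₃ * Real.exp ((δ 5 - δ 0) * (L₁ + L₂)) + (1 / κ₁ + 1) < |dslope (fun y : ℝ => Real.exp (y * (L₁ + L₂))) 0 (δ 5 - δ 0)|)
    (gΛ₂' : 1 / κ₂ * Real.exp ((δ 4 - δ 1) * L₁) + (1 / κ₁ + 1) < |dslope (fun y : ℝ => Real.exp (y * L₁)) 0 (δ 4 - δ 1)|)
    (gΛ₃' : 1 / κ₃ * Real.exp ((δ 4 - δ 1) * (L₁ + L₂)) + (1 / κ₁ + 1) < |dslope (fun y : ℝ => Real.exp (y * (L₁ + L₂))) 0 (δ 4 - δ 1)|)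
    (gΛL : 1 / κ₃ * Real.exp ((δ 5 - δ 0) * L₂) + (1 / κ₂ + 1) < |dslope (fun y : ℝ => Real.exp (y * L₂)) 0 (δ 5 - δ 0)|)
    (gΛL' : 1 / κ₃ * Real.exp ((δ 4 - δ 1) * L₂) + (1 / κ₂ + 1) < |dslope (fun y : ℝ => Real.exp (y * L₂)) 0 (δ 4 - δ 1)|)
    (hkill : 122880 * Φ ^ 18 * Real.exp (-|δ 0 - δ 1| * (L₁ + L₂)) < κ₁ ^ 4 * κ₂ ^ 2 * κ₃ ^ 3) : False := by
  -- symmetry of the frame vectors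
  have hV0 : (U 0 + U 5).IsSymm := (hU 0).add (hU 5)
  have hV1 : (U 1 + U 4).IsSymm := (hU 1).add (hU 4)
  have hV4 : ((δ 4 - δ 1) • U 4).IsSymm := (hU 4).smul _
  have hV5 : ((δ 5 - δ 0) • U 5).IsSymm := (hU 5).smul _
  -- the frame identities at the two later scales
  obtain ⟨i54₂, i04₂, i51₂, i01₂⟩ := mixed_frameShift δ U L₁
  obtain ⟨i54₃, i04₃, i51₃, i01₃⟩ := mixed_frameShift δ U (L₁ + L₂)
  obtain ⟨i55₂, i05₂, i00₂⟩ := triple_frameShift δ U L₁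
  obtain ⟨i55₃, i05₃, i00₃⟩ := triple_frameShift δ U (L₁ + L₂)
  obtain ⟨i44₂, i14₂, i11₂⟩ := triple_frameShift₁₄ δ U L₁
  obtain ⟨i44₃, i14₃, i11₃⟩ := triple_frameShift₁₄ δ U (L₁ + L₂)
  have E0₂ : 0 < Real.exp (δ 0 * L₁) := Real.exp_pos _
  have E1₂ : 0 < Real.exp (δ 1 * L₁) := Real.exp_pos _
  have E0₃ : 0 < Real.exp (δ 0 * (L₁ + L₂)) := Real.exp_pos _
  have E1₃ : 0 < Real.exp (δ 1 * (L₁ + L₂)) := Real.exp_pos _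
  have he₂ : 0 < Real.exp ((δ 5 - δ 0) * L₁) := Real.exp_pos _
  have he₂' : 0 < Real.exp ((δ 4 - δ 1) * L₁) := Real.exp_pos _
  have he₃ : 0 < Real.exp ((δ 5 - δ 0) * (L₁ + L₂)) := Real.exp_pos _
  have he₃' : 0 < Real.exp ((δ 4 - δ 1) * (L₁ + L₂)) := Real.exp_pos _
  have hA₂ : 0 < Real.exp (δ 0 * L₁) * Real.exp (δ 1 * L₁) := mul_pos E0₂ E1₂
  have hA₃ : 0 < Real.exp (δ 0 * (L₁ + L₂)) * Real.exp (δ 1 * (L₁ + L₂)) := mul_pos E0₃ E1₃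
  -- rewrite the mixed dominations / aliveness at the two later scales
  rw [i01₂, abs_mul, abs_of_pos hA₂] at d01₂
  rw [i04₂, abs_mul, abs_of_pos (mul_pos hA₂ he₂')] at d04₂
  rw [i51₂, abs_mul, abs_of_pos (mul_pos hA₂ he₂)] at d51₂
  rw [i54₂, abs_mul, abs_of_pos (mul_pos hA₂ (mul_pos he₂ he₂'))] at d54₂
  rw [i01₃, abs_mul, abs_of_pos hA₃] at d01₃
  rw [i04₃, abs_mul, abs_of_pos (mul_pos hA₃ he₃')] at d04₃
  rw [i51₃, abs_mul, abs_of_pos (mul_pos hA₃ he₃)] at d51₃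
  rw [i54₃, abs_mul, abs_of_pos (mul_pos hA₃ (mul_pos he₃ he₃'))] at d54₃
  have al₂' : κ₂ * μ₂ ≤ Real.exp (δ 0 * L₁) * Real.exp (δ 1 * L₁) * Real.exp ((δ 4 - δ 1) * L₁)
        * |polar (U 0 + U 5) ((δ 4 - δ 1) • U 4) + dslope (fun y : ℝ => Real.exp (y * L₁)) 0 (δ 5 - δ 0) * polar ((δ 5 - δ 0) • U 5) ((δ 4 - δ 1) • U 4)| ∨
      κ₂ * μ₂ ≤ Real.exp (δ 0 * L₁) * Real.exp (δ 1 * L₁) * Real.exp ((δ 5 - δ 0) * L₁)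
        * |polar ((δ 5 - δ 0) • U 5) (U 1 + U 4) + dslope (fun y : ℝ => Real.exp (y * L₁)) 0 (δ 4 - δ 1) * polar ((δ 5 - δ 0) • U 5) ((δ 4 - δ 1) • U 4)| := by
    rcases al₂ with h | h
    · left; rw [i04₂, abs_mul, abs_of_pos (mul_pos hA₂ he₂')] at h; exact h
    · right; rw [i51₂, abs_mul, abs_of_pos (mul_pos hA₂ he₂)] at h; exact h
  have al₃' : κ₃ * μ₃ ≤ Real.exp (δ 0 * (L₁ + L₂)) * Real.exp (δ 1 * (L₁ + L₂)) * Real.exp ((δ 4 - δ 1) * (L₁ + L₂))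
        * |polar (U 0 + U 5) ((δ 4 - δ 1) • U 4) + dslope (fun y : ℝ => Real.exp (y * (L₁ + L₂))) 0 (δ 5 - δ 0) * polar ((δ 5 - δ 0) • U 5) ((δ 4 - δ 1) • U 4)| ∨
      κ₃ * μ₃ ≤ Real.exp (δ 0 * (L₁ + L₂)) * Real.exp (δ 1 * (L₁ + L₂)) * Real.exp ((δ 5 - δ 0) * (L₁ + L₂))
        * |polar ((δ 5 - δ 0) • U 5) (U 1 + U 4) + dslope (fun y : ℝ => Real.exp (y * (L₁ + L₂))) 0 (δ 4 - δ 1) * polar ((δ 5 - δ 0) • U 5) ((δ 4 - δ 1) • U 4)| := by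
    rcases al₃ with h | h
    · left; rw [i04₃, abs_mul, abs_of_pos (mul_pos hA₃ he₃')] at h; exact h
    · right; rw [i51₃, abs_mul, abs_of_pos (mul_pos hA₃ he₃)] at h; exact h
  -- `Φ ≥ 1`, `ε`, and `12Φ⁶ε ≤ κ₃`
  set ε : ℝ := Real.exp (-|δ 0 - δ 1| * (L₁ + L₂)) with hεdef
  have hε : 0 < ε := Real.exp_pos _
  have hΦ1 : 1 ≤ Φ := by
    linarith only [hΦ₂, abs_nonneg (dslope (fun y : ℝ => Real.exp (y * L₁)) 0 (δ 5 - δ 0)), abs_nonneg (dslope (fun y : ℝ => Real.exp (y * L₁)) 0 (δ 4 - δ 1)), he₂, he₂',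
      inv_pos.mpr he₂, inv_pos.mpr he₂']
  have hsmall : 12 * Φ ^ 6 * ε ≤ κ₃ := kill_small hκ₁ hκ₂ hκ₃ hκ₁1 hκ₂1 hκ₃1 hΦ1 hε hkill
  -- the `D`-bound from the dominant pure class
  have hD : κ₃ * (polar (U 0 + U 5) (U 1 + U 4) * polar ((δ 5 - δ 0) • U 5) ((δ 4 - δ 1) • U 4)
      - polar (U 0 + U 5) ((δ 4 - δ 1) • U 4) * polar ((δ 5 - δ 0) • U 5) (U 1 + U 4)) ^ 2 ≤ 240 * Φ ^ 6 * ε * μ₁ ^ 4 := by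
    rcases lt_or_gt_of_ne hne with h01 | h10
    · -- `δ 0 < δ 1`: the class `2δ₁` dominates, `E₀ = ε E₁`
      have hεeq : ε = Real.exp ((δ 0 - δ 1) * (L₁ + L₂)) := by
        rw [hεdef, abs_of_neg (sub_neg.mpr h01)]; congr 1; ring
      have hE0 : Real.exp (δ 0 * (L₁ + L₂)) = ε * Real.exp (δ 1 * (L₁ + L₂)) := by
        rw [hεeq, ← Real.exp_add]; congr 1; ring
      have al₃'' := al₃'
      rw [hE0] at al₃''
      rw [i44₃, abs_mul, abs_of_pos (mul_pos (mul_pos E1₃ E1₃) (mul_pos he₃' he₃'))] at d44₃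
      rw [i14₃, abs_mul, abs_of_pos (mul_pos (mul_pos E1₃ E1₃) he₃')] at d14₃
      rw [i11₃, abs_mul, abs_of_pos (mul_pos E1₃ E1₃)] at d11₃
      exact mixThree_Dsq_le₁ _ _ _ _ hV0 hV5 hV1 hV4 hκ₃ hμ₁ E1₃ hε he₃ he₃' b00 b05 b55 b01 b04 b51 b54 al₃'' d44₃ d14₃ d11₃ hΦ₃ hsmall
    · -- `δ 1 < δ 0`: the class `2δ₀` dominates, `E₁ = ε E₀`
      have hεeq : ε = Real.exp ((δ 1 - δ 0) * (L₁ + L₂)) := by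
        rw [hεdef, abs_of_pos (sub_pos.mpr h10)]; congr 1; ring
      have hE1 : Real.exp (δ 1 * (L₁ + L₂)) = ε * Real.exp (δ 0 * (L₁ + L₂)) := by
        rw [hεeq, ← Real.exp_add]; congr 1; ring
      have al₃'' := al₃'
      rw [hE1] at al₃''
      rw [i55₃, abs_mul, abs_of_pos (mul_pos (mul_pos E0₃ E0₃) (mul_pos he₃ he₃))] at d55₃
      rw [i05₃, abs_mul, abs_of_pos (mul_pos (mul_pos E0₃ E0₃) he₃)] at d05₃
      rw [i00₃, abs_mul, abs_of_pos (mul_pos E0₃ E0₃)] at d00₃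
      exact mixThree_Dsq_le₀ _ _ _ _ hV0 hV5 hV1 hV4 hκ₃ hμ₁ E0₃ hε he₃ he₃' b11 b14 b44 b01 b04 b51 b54 al₃'' d55₃ d05₃ d00₃ hΦ₃ hsmall
  -- nested-shift identities
  have hshift : dslope (fun y : ℝ => Real.exp (y * (L₁ + L₂))) 0 (δ 5 - δ 0) - dslope (fun y : ℝ => Real.exp (y * L₁)) 0 (δ 5 - δ 0)
      = Real.exp ((δ 5 - δ 0) * L₁) * dslope (fun y : ℝ => Real.exp (y * L₂)) 0 (δ 5 - δ 0) := dslope_exp_shift_sub L₁ L₂ (δ 5 - δ 0)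
  have hshift' : dslope (fun y : ℝ => Real.exp (y * (L₁ + L₂))) 0 (δ 4 - δ 1) - dslope (fun y : ℝ => Real.exp (y * L₁)) 0 (δ 4 - δ 1)
      = Real.exp ((δ 4 - δ 1) * L₁) * dslope (fun y : ℝ => Real.exp (y * L₂)) 0 (δ 4 - δ 1) := dslope_exp_shift_sub L₁ L₂ (δ 4 - δ 1)
  have he₃L : Real.exp ((δ 5 - δ 0) * (L₁ + L₂)) = Real.exp ((δ 5 - δ 0) * L₁) * Real.exp ((δ 5 - δ 0) * L₂) := by rw [← Real.exp_add]; congr 1; ring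
  have he₃L' : Real.exp ((δ 4 - δ 1) * (L₁ + L₂)) = Real.exp ((δ 4 - δ 1) * L₁) * Real.exp ((δ 4 - δ 1) * L₂) := by rw [← Real.exp_add]; congr 1; ring
  exact mixThree_scalar hκ₁ hκ₂ hκ₃ hκ₂1 hκ₃1 hμ₁ hA₂ hA₃ he₂ he₂' he₃ he₃' hε hal₁ b01 al₂' d01₂ d04₂ d51₂ d54₂ al₃' d01₃ d04₃ d51₃ d54₃
    hD hΦ₂ hΦ₃ gΛ₂ gΛ₃ gΛ₂' gΛ₃' hshift he₃L gΛL hshift' he₃L' gΛL' hkill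

end Summit.ValiantsHypothesis.ValiantsHypothesis.Theorems.LacunarySymmetroidMatrixDescartes.WallBubbling
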